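import Summits.HodgeConjecture.HodgeCM.StubTree.Qw8MilnePosNoH0_1

/-! PORT of `HodgeCM/StubTree/Qw8MilnePosNoH0.lean` (HodgeCMPerL run 82) — part 2: continuation of `Summits.HodgeConjecture.HodgeCM.StubTree.Qw8MilnePosNoH0_1` (split at a top-level declaration boundary by port_pkg.py; scope re-opened below; declarations unchanged). -/

-- port_pkg: scope re-opened for this part (file-level context, then the namespace/section stack open at the cut)
noncomputable section
open scoped TensorProduct NumberField BigOperators Classical
open Polynomial
namespace HodgeCM
open Literature.AlgebraicGeometry.Motives (CMType HodgeStructure)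
open Literature.AlgebraicGeometry.Motives.HodgeStructure (ofRat ofRat_apply)
open HodgeCM.Pohlmann HodgeCM.GaoUllmo HodgeCM.CMTypeOps
namespace Universe
variable {U : Universe}
/-- **`Qw8MilnePos` — the positive-degree half of [QW8] Thm 2.5 (sufficiency) — is a theorem of `ModelAxioms` (M1–M28),
N1, N2, F4, F5: NO degree-zero input** (compare `qw8MilnePos_of_facts₃` with N3, `qw8MilnePos_of_facts₄` with
`Fact_pull_H0_cmProd`, `qw8MilnePos_of_unitH0` with F-H0). -/
theorem qw8MilnePos_of_facts₅ (M : U.ModelAxioms) (hN1 : U.Fact_cupExterior) (hN2 : U.Fact_cup_hodge)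
    (h4 : U.Fact_cupAlg) (h5 : U.Fact_cupAssoc) : U.Qw8MilnePos := by
  intro F hG _h6 z hp hz
  obtain ⟨n, Θ, p, S, x, hx0, hxw⟩ := z
  change 0 < p at hp
  change lefChar Θ S = 0 at hz
  change x ∈ U.algC (U.cmProd F Θ) p
  obtain ⟨m, rfl⟩ : ∃ m, p = m + 1 := ⟨p - 1, by omega⟩
  have hk : 2 * m + 1 + 1 = 2 * (m + 1) := by ring
  have hx' : U.castC _ hk.symm x ∈ U.weightSpace F Θ S (2 * m + 1 + 1) :=
    (U.mem_weightSpace_iff F Θ S _ _).2 (U.isWeightVector_castC F Θ S hk.symm hxw)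
  have h := weightSpace_le_algC_of_lefChar_eq_zero₅ M hN1 hN2 h4 h5 m (2 * m + 1) hk hz hx'
  rw [Submodule.mem_comap, LinearEquiv.coe_coe, castC_castC, castC_self] at h
  exact h

/-- The run-27/28 forms as corollaries (documentation): M29 as a Prop is not needed in positive degree. -/
theorem qw8MilnePos_of_facts₃_of₅ (M : U.ModelAxioms) (hN1 : U.Fact_cupExterior) (hN2 : U.Fact_cup_hodge)
    (_hN3 : U.Fact_pull_H0) (h4 : U.Fact_cupAlg) (h5 : U.Fact_cupAssoc) : U.Qw8MilnePos :=
  qw8MilnePos_of_facts₅ M hN1 hN2 h4 h5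

/-! ## §5 Gao–Ullmo Thm 3.1 (Pohlmann) at every POSITIVE level from `ModelAxioms`, N1, N2 — no degree-zero fact -/

section PohlmannPos

variable {F : CMField} {n : ℕ} {Θ : Fin (n + 1) → CMType F}

/-- **Pohlmann's span inclusion at level `p`, any CM field, from M1–M28, M29 AND M30 in degree `2p` only**
(`pohlmannSpanCMAt_of_weightHodgeAt` verbatim over `baseChange_hodgeClassesOf_le_iSupC_at`). -/
theorem pohlmannSpanCMAt_at (M : U.ModelAxioms) {p : ℕ} (h29 : U.Fact_weightSpanAt (2 * p))
    (h30 : U.Fact_weightHodgeAt (2 * p)) (F : CMField) (n : ℕ) (Θ : Fin (n + 1) → CMType F) :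
    (U.hodgeClassesOf (U.cmProd F Θ) p).map ofRat ≤
      (Submodule.span ℂ {x : U.CohC (U.cmProd F Θ) (2 * p) |
          ∃ S : Fin (n + 1) → Finset ((F : Type) →+* ℂ),
            IsHodgeWeightC Θ p S ∧ U.IsWeightVector F Θ S (2 * p) x}).restrictScalars ℚ := by
  obtain ⟨j, a, c, hinj⟩ := exists_separating_family (F := (F : Type)) n
  choose Mi hMi using fun i => exists_isFactorAct M F Θ (j i) (a i)
  have hinj' : Function.Injective (sepVal j a c) := hinj
  rw [Submodule.map_le_iff_le_comap]
  intro b hb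
  rw [Submodule.mem_comap, Submodule.restrictScalars_mem]
  have hbC : ofRat b ∈ (U.hodgeClassesOf (U.cmProd F Θ) p).baseChange ℂ :=
    Submodule.tmul_mem_baseChange_of_mem 1 hb
  refine (baseChange_hodgeClassesOf_le_iSupC_at M h29 h30 hMi hinj').trans ?_ hbC
  exact iSup₂_le fun S hS x hx => Submodule.subset_span ⟨S, hS, (U.mem_weightSpace_iff F Θ S (2 * p) x).1 hx⟩

/-- At a POSITIVE level `p + 1` Pohlmann's equality `B^{p+1} ⊗ ℂ = ⨆_{S : IsHodgeWeightC} V_S` holds from `ModelAxioms` + N1 + N2 ONLY,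
any CM field (compare `baseChange_hodgeClassesOf_eq_iSupC_of_pos (M) (hN1) (hN2) (hN3)`, which took N3 through M29 in all degrees). -/
theorem baseChange_hodgeClassesOf_eq_iSupC_succ_of_facts₅ (M : U.ModelAxioms) (hN1 : U.Fact_cupExterior)
    (hN2 : U.Fact_cup_hodge) (p : ℕ) :
    (U.hodgeClassesOf (U.cmProd F Θ) (p + 1)).baseChange ℂ =
      ⨆ (S : Fin (n + 1) → Finset ((F : Type) →+* ℂ)) (_ : IsHodgeWeightC Θ (p + 1) S),
        U.weightSpace F Θ S (2 * (p + 1)) := by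
  obtain ⟨j, a, c, hinj⟩ := exists_separating_family (F := (F : Type)) n
  choose Mi hMi using fun i => exists_isFactorAct M F Θ (j i) (a i)
  have hinj' : Function.Injective (sepVal j a c) := hinj
  have h29 : U.Fact_weightSpanAt (2 * (p + 1)) := fact_weightSpanAt_succ M hN1 (2 * p + 1)
  have h30 : U.Fact_weightHodgeAt (2 * (p + 1)) := weightHodgeAt_succ_of_facts M hN1 hN2 (2 * p + 1)
  exact baseChange_hodgeClassesOf_eq_iSupC_at M h29 h30 hMi hinj'

/-- **Pohlmann's span inclusion at every positive level from `ModelAxioms` + N1 + N2 only**, any CM field. -/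
theorem pohlmannSpanCMAt_succ_of_facts₅ (M : U.ModelAxioms) (hN1 : U.Fact_cupExterior) (hN2 : U.Fact_cup_hodge)
    (p : ℕ) (F : CMField) (n : ℕ) (Θ : Fin (n + 1) → CMType F) :
    (U.hodgeClassesOf (U.cmProd F Θ) (p + 1)).map ofRat ≤
      (Submodule.span ℂ {x : U.CohC (U.cmProd F Θ) (2 * (p + 1)) |
          ∃ S : Fin (n + 1) → Finset ((F : Type) →+* ℂ),
            IsHodgeWeightC Θ (p + 1) S ∧ U.IsWeightVector F Θ S (2 * (p + 1)) x}).restrictScalars ℚ :=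
  pohlmannSpanCMAt_at M (fact_weightSpanAt_succ M hN1 (2 * p + 1))
    (weightHodgeAt_succ_of_facts M hN1 hN2 (2 * p + 1)) F n Θ

/-- **Gao–Ullmo Thm 3.1 "(Pohlmann)", both sentences (basis of `B^p ⊗ ℂ` indexed by the Galois-closure Hodge weights +
`dim_ℚ B^p = #` such weights), every level `p ≥ 1`, ANY CM field, from `ModelAxioms` (M1–M28) + N1 + N2 ONLY** — no N3, no
`Fact_pull_H0_cmProd`, no F-H0, no N4, no M42 (compare `pohlmannTheorem31CM_of_facts₃ (M)(hN1)(hN2)(hN3)`, run 27, and this seat's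
`pohlmannTheorem31CM_of_facts₄ (…) (h3 : Fact_pull_H0_cmProd)`, run 29 row #3; the proof of `₃` verbatim over
`baseChange_hodgeClassesOf_eq_iSupC_succ_of_facts₅`). -/
theorem pohlmannTheorem31CM_of_facts₅ (M : U.ModelAxioms) (hN1 : U.Fact_cupExterior) (hN2 : U.Fact_cup_hodge) :
    U.PohlmannTheorem31CM := fun F n Θ p hp => by
  obtain ⟨q, rfl⟩ : ∃ q, p = q + 1 := ⟨p - 1, by omega⟩
  have hl : ∀ S : Fin (n + 1) → Finset ((F : Type) →+* ℂ), IsHodgeWeightC Θ (q + 1) S →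
      Module.finrank ℂ (U.weightSpace F Θ S (2 * (q + 1))) = 1 := fun S hS => by
    rw [finrank_weightSpace M hN1 (by omega) S, if_pos hS.1]
  obtain ⟨b, hb⟩ := exists_basis_hodgeClassesOf_C_of_eq (F := F) (n := n) (Θ := Θ) M (q + 1)
    (baseChange_hodgeClassesOf_eq_iSupC_succ_of_facts₅ M hN1 hN2 q) hl
  refine ⟨⟨b, hb⟩, ?_⟩
  rw [← Module.finrank_eq_nat_card_basis b,
    ← (Submodule.toBaseChange.toLinearEquiv ℂ (U.hodgeClassesOf (U.cmProd F Θ) (q + 1))).finrank_eq,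
    Module.finrank_baseChange]

/-- … hence the Galois statement `PohlmannTheorem31` (WeightLines.lean; levels `p ≥ 1`) from `ModelAxioms` + N1 + N2 ONLY. -/
theorem pohlmannTheorem31_of_facts₅ (M : U.ModelAxioms) (hN1 : U.Fact_cupExterior) (hN2 : U.Fact_cup_hodge) :
    U.PohlmannTheorem31 :=
  pohlmannTheorem31_of_pohlmannTheorem31CM (pohlmannTheorem31CM_of_facts₅ M hN1 hN2)

end PohlmannPos

end Universe

end HodgeCM

end
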